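import Summits.BirchSwinnertonDyer.BirchSwinnertonDyer.Theses.UniversalToricDescent
import Summits.BirchSwinnertonDyer.BirchSwinnertonDyer.Theorems.UniversalToricDescentRoadFFCpIntMemberTower
import Summits.BirchSwinnertonDyer.BirchSwinnertonDyer.Theorems.UniversalToricDescentSelfMuZeroAtThree
import Summits.BirchSwinnertonDyer.BirchSwinnertonDyer.Theorems.UniversalToricDescentTwinDecLocusCubeTest
import Literature.NumberTheory.EllipticCurves.Skinner2016.HidaCongruentMembers
import Literature.NumberTheory.EllipticCurves.NonEisensteinPrimeOfSurjective
import Literature.NumberTheory.EllipticCurves.Castella2018.HidaMembersFramesSigmaCongruenceOddPrime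
import Literature.NumberTheory.EllipticCurves.HeegnerPointsProofs
import Literature.NumberTheory.EllipticCurves.PastenValuationProductThm75ExplicitProofs
import HarnessLib

/-!
# Route `UniversalToricDescent`, ♭B′ `TwinWanFrameAtThreeMultTresT` (stmt-BirchSwinnertonDyer-27401) BY NAME from TWO PUBLISHED FACTS —
# Hsieh 2014 Thm B (`Hsieh2014.thmB_…_anyLevel`) and Castella 2020 §2 / Skinner 2016 §2.6 at an odd prime
# (`Castella2018.castella2020_thm211_members_frames_sigma_congruence_odd`, p633915) — AND ONE RESEARCH STATEMENT, K1-at-3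
# «the one-newform RATIONAL Wan-side anticyclotomic inclusion in weight `k` at split `p = 3` under an all-split `K`»
# (the kernel-checked glue of line `membertower` v11; lead bsd-wall-utd-p2 g13, 2026-08-28)

`--supports stmt-BirchSwinnertonDyer-27401 --as helper`. ONE theorem, `twinWanFrameAtThreeMultTresT_of_thmB_of_castella2020odd_of_rationalInclusion`:
hypotheses = the two named Literature facts + VERBATIM the registered research stub `stub_memberRationalInclusionAtThree` of skeleton v11;
conclusion = the route declaration `Summit.BirchSwinnertonDyer.BirchSwinnertonDyer.Theses.UniversalToricDescent.TwinWanFrameAtThreeMultTresT`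
BY NAME. Chain: the odd-`p` fact at the twin (♭B′ binders ⟹ its binders: `Dt'.isNewformOf`, `Irr` from `ρ̄₃` onto, `3 ≤ N′/3` from
`Pasten2024.eleven_le_level`, Heegner residue from `exists_dvd_sq_sub_discr_holds`, `3` split from the degree-one `𝔭`, `BranchInducesPrime`
= the `𝔭`-via-`ι` clause) gives the `R₀`-frame `(Ω_K, Ω_p ∈ R₀ˣ, L)` and per level an `ι′`-compatible member with a typed Σ-frame
`Q_m ∈ 𝓞_{ℂ₃}⟦T⟧` (same periods) and (c); K1-at-3 at THAT frame gives the rational inclusion; `μ(L) = 0` from Thm B; (dec) from the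
très-ramifié binder; the Wan clause under torsion is p633686. CONDITIONAL exactly on {PUB, PUB, K1-at-3}; nothing is booked; classes
closed 0; BSD is proved for no curve. References: [Hsieh2014] Thm. B; [Castella2020JIMJ] §2 Def. 2.10, Thm. 2.11; [Skinner2016PacificMC]
§2.6, §3.1; [Castella2018Erratum] proof of Thm. 1.1 (c); [YanZhu2026] Thm. 4.4, 4.7, 5.7 (1) (shape of K1 in weight 2); [Serre1987] §2.9 Prop. 5.
-/

noncomputable section

open scoped Classical

set_option linter.dupNamespace false
set_option autoImplicit false

namespace Summit.BirchSwinnertonDyer.BirchSwinnertonDyer.Theorems.UniversalToricDescentTwinWanFrameAtThreeMultTresT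

open PowerSeries WeierstrassCurve NumberField IsDedekindDomain Field
  Literature.NumberTheory.EllipticCurves
  Literature.NumberTheory.EllipticCurves.ModularForms
  Literature.NumberTheory.EllipticCurves.Rank1Residual
  Literature.NumberTheory.EllipticCurves.BigGaloisRep
  Literature.NumberTheory.EllipticCurves.GreenbergSelmer
  Literature.NumberTheory.GaloisRepresentations
  Summit.BirchSwinnertonDyer.Rank1Residual.X11b
  Summit.BirchSwinnertonDyer.Rank1Residual.X11b.Halves
  Summit.BirchSwinnertonDyer.BirchSwinnertonDyer.Theorems.SchneiderFree
  Summit.BirchSwinnertonDyer.BirchSwinnertonDyer.Theorems.UniversalToricDescentTwinTorsionRankOne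
  Summit.BirchSwinnertonDyer.BirchSwinnertonDyer.Theorems.UniversalToricDescentTwinDecLocus

set_option maxHeartbeats 800000 in
/-- **♭B′ `TwinWanFrameAtThreeMultTresT` BY NAME from Hsieh Thm B + Castella 2020 §2 at odd `p` + K1-at-3** (glue of `membertower` v11).
`hB` = `Hsieh2014.thmB_exists_isHsiehLFunction_coeff_norm_eq_one_unrPeriod_anyLevel` (PUBLISHED); `hC` =
`Castella2018.castella2020_thm211_members_frames_sigma_congruence_odd` (PUBLISHED-by-reading at `p = 3`, flag MF-odd-p, p633915); `hK1` =
VERBATIM `stub_memberRationalInclusionAtThree` (RESEARCH): for every `ι′`-compatible Hida member `D` of `f_{W′}`, characterised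
`b : 𝒪_m → 𝓞_{ℂ₃}` and Σ-imprimitive weight-`k_m` frame `(Ω_K ≠ 0, Ω_p ∈ 𝓞_{ℂ₃}ˣ, Q)` of `D.g`: torsion of `X^Σ_ac(A_{g_m}; 𝔭′)` ⟹
`∃ e, (C 3)^e·Ch·𝓞_{ℂ₃}⟦T⟧ ⊆ (Q)`. [cite: Hsieh2014, Thm. B p. 712] [cite: Castella2020JIMJ, §2 Def. 2.10, Thm. 2.11]
[cite: Skinner2016PacificMC, §2.6 (2-6-1), §3.1 (p. 192)] [cite: Serre1987, §2.9 Prop. 5] -/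
theorem twinWanFrameAtThreeMultTresT_of_thmB_of_castella2020odd_of_rationalInclusion
    (hB : Hsieh2014.thmB_exists_isHsiehLFunction_coeff_norm_eq_one_unrPeriod_anyLevel)
    (hC : Castella2018.castella2020_thm211_members_frames_sigma_congruence_odd)
    (hK1 :
      ∀ (W' : WeierstrassCurve ℚ) [W'.IsElliptic] [W'.IsGloballyMinimal] (N' : ℕ) [NeZero N']
        (K : Type) [Field K] [NumberField K] (Dt' : ModularParametrizationData W' N'),
        Mult W' 3 → W'.HasSurjectiveModNGaloisRep 3 → W'.conductorNorm ℤ = N' → IsImaginaryQuadratic K →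
        SatisfiesHeegnerHypothesis N' K → Odd (NumberField.discr K) →
        ∀ (κ : ZpExtension K 3), κ.IsAnticyclotomic → ∀ (γ : absoluteGaloisGroup K) [Fact (κ.IsTopGenerator γ)]
          (𝔭 : HeightOneSpectrum (𝓞 K)), ((3 : ℕ) : 𝓞 K) ∈ 𝔭.asIdeal →
          𝔭.asIdeal.ramificationIdx (𝓞 ℚ) = 1 → 𝔭.asIdeal.inertiaDeg (𝓞 ℚ) = 1 →
          ∀ (𝔭' : HeightOneSpectrum (𝓞 K)), ((3 : ℕ) : 𝓞 K) ∈ 𝔭'.asIdeal → 𝔭' ≠ 𝔭 →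
          ∀ (ι' : PadicAlgCl 3 ≃+* ℂ), BranchInducesPrime 3 ι' 𝔭 →
          ∀ (m : ℕ) (D : Skinner2016.HidaCongruentMember W' 3 m), (∀ x : coeffField D.g, ι' (D.ι x) = (x : ℂ)) →
          ∀ (b : padicCoeffIntegers D.ι →+* 𝓞_ℂ_[3]),
            (∀ x, ((b x : 𝓞_ℂ_[3]) : ℂ_[3]) = algebraMap (PadicAlgCl 3) ℂ_[3] (padicCoeffIntegers.toPadicAlgCl D.ι x)) →
          ∀ (ΩK : ℂ) (Ωp : (𝓞_ℂ_[3])ˣ) (Q : PowerSeries 𝓞_ℂ_[3]), ΩK ≠ 0 →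
            IsBDPLFunctionWtSigmaInt ι' 𝔭 κ γ D.g (W'.sigmaPlacesFinset 3 K) ΩK ((Ωp : 𝓞_ℂ_[3]) : ℂ_[3]) Q →
          ∀ [TopologicalSpace (PowerSeries (padicCoeffIntegers D.ι))]
            [ContinuousSMul (PowerSeries (padicCoeffIntegers D.ι))
              (BigRepModule (padicCoeffIntegers D.ι) 3 (Cofree D.Δ.ρ (padicCoeffField D.ι)))],
            Module.IsTorsion (PowerSeries (padicCoeffIntegers D.ι))
                (XBig κ (D.Δ.cofreeRepOver K) 𝔭' (↑(W'.sigmaPlacesFinset 3 K))) →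
              ∃ e : ℕ, Ideal.span {(PowerSeries.C ((3 : ℕ) : 𝓞_ℂ_[3]) : PowerSeries 𝓞_ℂ_[3]) ^ e} *
                  (XBig.charIdeal κ (D.Δ.cofreeRepOver K) 𝔭' (↑(W'.sigmaPlacesFinset 3 K))).map (PowerSeries.map b) ≤
                Ideal.span {Q}) :
    Summit.BirchSwinnertonDyer.BirchSwinnertonDyer.Theses.UniversalToricDescent.TwinWanFrameAtThreeMultTresT := by
  intro W' _ _ N' _ K _ _ Dt' hmult hsurj hN' hK hH hodd hndvd κ hκ γ _ 𝔭 h𝔭 he hf 𝔭' h𝔭' hne ι' hι'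
  -- (dec) from the très-ramifié binder
  have hdec : ∀ Q : (W'.baseChange ℚ_[3]).toAffine.Point, 3 • Q = 0 → Q = 0 :=
    twin_dec_of_forall_not_cube W' hmult (forall_not_exists_pow_of_nonsplit_or_not_dvd W' (Or.inr hndvd))
  -- the odd-`p` fact's binders from ♭B′'s
  have hirr : Irr W' 3 := hasIrreducibleModPGaloisRep_of_hasSurjectiveModNGaloisRep W' 3 hsurj
  have hM : 3 ≤ N' / 3 := by
    have h11 := Pasten2024.eleven_le_level Dt'
    omega
  have hβ : ∃ β : ℤ, (4 * N' : ℤ) ∣ β ^ 2 - NumberField.discr K := exists_dvd_sq_sub_discr_holds N' K hK hH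
  have hsplit : ((Ideal.span {((3 : ℕ) : ℤ)}).primesOver (𝓞 K)).ncard = 2 :=
    ncard_primesOver_eq_two_of_degreeOne hK.1 h𝔭 he hf
  obtain ⟨ΩK, Ωp, L, hΩK, hL, hmem⟩ := hC ι' W' K 𝔭 κ γ Dt'.isNewformOf hN' (by decide) hmult hM hirr hK hodd hβ hsplit h𝔭 hι'
    hκ (R1.unrToCpInt 3) (toUnr 3) (R1.coe_unrToCpInt 3) (coe_toUnr 3)
  have hΩp' : (((Units.map (R1.unrToCpInt 3 : unrIntegers 3 →* 𝓞_ℂ_[3]) Ωp : (𝓞_ℂ_[3])ˣ) : 𝓞_ℂ_[3]) : ℂ_[3]) =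
      ((Ωp : unrIntegers 3) : ℂ_[3]) := by
    rw [Units.coe_map, MonoidHom.coe_coe, R1.coe_unrToCpInt]
  have hΩp0 : ((Ωp : unrIntegers 3) : ℂ_[3]) ≠ 0 := fun h0 ↦
    Ωp.ne_zero ((ZeroMemClass.coe_eq_zero).mp h0)
  -- `μ(L) = 0` from Thm B (♭-witness moved across periods, p538896)
  have hμL : ∃ i : ℕ, IsUnit (PowerSeries.coeff i L) := by
    obtain ⟨ΩK₁, Ωp₁, Q, hΩK₁, hΩp₁, hQ, hμQ⟩ :=
      Summit.BirchSwinnertonDyer.BirchSwinnertonDyer.Theorems.UniversalToricDescentSelfMuZero.self_exists_isBDPLFunctionInt_coeff_norm_eq_one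
        hB W' N' K Dt' hsurj hK hH κ hκ γ 𝔭 h𝔭 he hf ι' hι'
    have hΩp₁0 : Ωp₁ ≠ 0 := fun h ↦ by rw [h, norm_zero] at hΩp₁; exact zero_ne_one hΩp₁
    obtain ⟨i, hi⟩ :=
      Summit.BirchSwinnertonDyer.BirchSwinnertonDyer.Theorems.UniversalToricDescentFlatMuTransfer.exists_coeff_norm_eq_one_of_isBDPLFunctionInt_of_isBDPLFunction
        hK hκ Fact.out hΩK₁ hΩK hΩp₁0 hΩp0 hQ hL hμQ
    exact ⟨i, (unrIntegers.isUnit_iff_norm_eq_one _).mpr hi⟩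
  refine ⟨ΩK, ((Ωp : unrIntegers 3) : ℂ_[3]), L, hΩK, hΩp0, hL, fun hT₀ ↦ ?_⟩
  refine twin_exists_forall_C_pow_mul_mem_span_of_cpIntMemberTower_of_isTorsion
    SkinnerUrban2014.prop323_XAc_equiv_XBigDecomp_holds W' N' K hmult hsurj hN' hK hH κ hκ γ 𝔭' h𝔭' hdec hT₀ L hμL
    fun m hm ↦ ?_
  exact (hmem m hm).elim fun D hD ↦ hD.elim fun Qm hQ ↦
    ⟨D, Qm, fun b hb hT ↦ hK1 W' N' K Dt' hmult hsurj hN' hK hH hodd κ hκ γ 𝔭 h𝔭 he hf 𝔭' h𝔭' hne ι' hι' m D hQ.1 b hb ΩK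
      (Units.map (R1.unrToCpInt 3 : unrIntegers 3 →* 𝓞_ℂ_[3]) Ωp) Qm hΩK (hΩp' ▸ hQ.2.2.2.1) hT, hQ.2.2.2.2⟩

end Summit.BirchSwinnertonDyer.BirchSwinnertonDyer.Theorems.UniversalToricDescentTwinWanFrameAtThreeMultTresT

end
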